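import Mathlib
import Literature.MathematicalPhysics.StatisticalMechanics.LennardJonesClusters
import Literature.Geometry.DiscreteGeometry.KissingPatterns
import Summits.AtomisticToContinuum.Crystallization.Theorems.ChargedEnergyGap.Negative.Unconditional
import HarnessLib

/-!
# Periodic rungs of the special side of route `FrustratedLawDichotomy` (lens 2, g14)

Item `PeriodicFrustratedLawGap` (Φper, stmt-AtomisticToContinuum-27624) of route
`FrustratedLawDichotomy` says that no point-stationary textured Nash hard-core law charging
PERIODIC atom sets is an exact Lennard-Jones minimiser.  Generation 14 of the decomp-a2c cell
de-randomises it (node «PeriodicChargeSplit»: Φper ⟸ R ∧ D) into a measure-theoretic charging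
lemma R and the deterministic content

  D `NoFrustratedPeriodicMinimiser`:  for every `δ > 0`, every periodic configuration `Q` and
  translation `t` such that `S = Q.points + t` is `δ`-separated, textured and Nash,
  `e⋆ < Q.energyPerParticle V_LJ`   (`e⋆ = ⨅ Q, e(Q)`).

THIS FILE PROVES, sorry-free, the first rungs of D's ladder:

* `eStar_lt_energyPerParticle_of_three_le` — the DILUTE rung: for `δ ≥ 3` every periodic
  configuration a translate of whose point set is `δ`-separated has `e⋆ < e(Q)` (texture and the
  Nash clause not even needed: `e(Q) ≥ -(250/12)·δ⁻⁶ ≥ -0.0286 > -1/24 ≥ e⋆`, the last inequality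
  from the periodised unit dimer, tree theorem `eStar_le_groundStateEnergy_div`);
  `noFrustratedPeriodicMinimiser_dilute_rung` restates it in D's exact binder shape
  (`0 < δ` replaced by `3 ≤ δ`);
* (companion file `FrustratedLawDichotomyFccRung`, kept separate because it imports the heavy
  certified lattice-sum kernels `HcpFccLatticeSums*`) `eStar_lt_fcc_energyPerParticle` — the first
  CERTIFIED-LATTICE-SUM rung: every cubic fcc lattice has `e⋆ < e(fcc)`, from the tree's
  `lennardJones_hcp_below_fcc` and `eStar_le`.

The helper `tsum` form of the Literature shell bound `sum_inv_pow_six_le` is derived here (the finite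
re-indexing and `e⋆ ≤ -1/24` are inlined; their stand-alone forms are the landed
`UnimodularEnergy.sum_erase_inv_pow_six_le` and `PricedLinkCensusLocalToGlobalPhaseGap.eStar_le_neg`,
whose modules are not imported to keep this file's import closure on the always-built core).  The rungs lie outside any proved regime of
`Crystallization` (which has none in three dimensions) and exercise the route's lever — the sign
of `e(Q) - e⋆` for ONE periodic competitor at a time, decided by a tail bound resp. a certified
lattice sum.
-/

noncomputable section

namespace Summit.AtomisticToContinuum.Crystallization.Theorems.FrustratedLawDichotomyPeriodicRungs

open MeasureTheory Metric Set
open Literature.MathematicalPhysics.StatisticalMechanics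
open Summit.AtomisticToContinuum.Crystallization.Theorems.ChargedEnergyGapNegative
  (eStar eStar_le_groundStateEnergy_div dimer dimer_injective interactionEnergy_dimer)

/-! ### `δ`-separated sets: the shell bound in `tsum` form -/

section Separated

variable {δ : ℝ} {S : Set (EuclideanSpace ℝ (Fin 3))}

/-- Shell bound, `tsum` form over the punctured set: for `x` in a `δ`-separated `S`,
`y ↦ (dist x y)⁻⁶` is summable over `{y ∈ S, y ≠ x}` with sum `≤ 250 δ⁻⁶`. [folklore] -/
theorem summable_inv_pow_six (hδ : 0 < δ)
    (hsep : ∀ a ∈ S, ∀ b ∈ S, a ≠ b → δ ≤ dist a b) {x : EuclideanSpace ℝ (Fin 3)} (hx : x ∈ S) :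
    Summable (fun y : {y : EuclideanSpace ℝ (Fin 3) // y ∈ S ∧ y ≠ x} => (dist x y.1)⁻¹ ^ 6) ∧
      ∑' y : {y : EuclideanSpace ℝ (Fin 3) // y ∈ S ∧ y ≠ x}, (dist x y.1)⁻¹ ^ 6 ≤ 250 * δ⁻¹ ^ 6 := by
  classical
  have hnn : ∀ y : {y : EuclideanSpace ℝ (Fin 3) // y ∈ S ∧ y ≠ x}, 0 ≤ (dist x y.1)⁻¹ ^ 6 := fun y => by positivity
  have hbd : ∀ T' : Finset {y : EuclideanSpace ℝ (Fin 3) // y ∈ S ∧ y ≠ x},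
      ∑ y ∈ T', (dist x y.1)⁻¹ ^ 6 ≤ 250 * δ⁻¹ ^ 6 := by
    intro T'
    set M : Finset (EuclideanSpace ℝ (Fin 3)) := T'.map (Function.Embedding.subtype _) with hM
    have hxM : x ∉ M := by
      intro h
      obtain ⟨w, -, hw⟩ := Finset.mem_map.1 h
      exact w.2.2 hw
    set T : Finset (EuclideanSpace ℝ (Fin 3)) := insert x M with hT
    have hTS : ∀ z ∈ T, z ∈ S := by
      intro z hz
      rcases Finset.mem_insert.1 hz with rfl | hz
      · exact hx
      · obtain ⟨w, -, rfl⟩ := Finset.mem_map.1 hz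
        exact w.2.1
    have hsepT : ∀ a ∈ T, ∀ b ∈ T, a ≠ b → δ ≤ dist a b := fun a ha b hb hab =>
      hsep a (hTS a ha) b (hTS b hb) hab
    -- the finite shell bound `∑_{z ∈ T, z ≠ x} (dist x z)⁻⁶ ≤ 250 δ⁻⁶` (Literature `sum_inv_pow_six_le`,
    -- re-indexed from `Fin n` to the finset `T`; = `UnimodularEnergy.sum_erase_inv_pow_six_le`, inlined)
    have h : ∑ z ∈ T.erase x, (dist x z)⁻¹ ^ 6 ≤ 250 * δ⁻¹ ^ 6 := by
      have hxT : x ∈ T := Finset.mem_insert_self x M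
      set e : {z // z ∈ T} ≃ Fin T.card := T.equivFin with he
      set xs : Fin T.card → EuclideanSpace ℝ (Fin 3) := fun i => (e.symm i : EuclideanSpace ℝ (Fin 3)) with hxs
      have hxsep : ∀ k l, k ≠ l → δ ≤ dist (xs k) (xs l) := fun k l hkl =>
        hsepT _ (e.symm k).2 _ (e.symm l).2 fun h => hkl (e.symm.injective (Subtype.ext h))
      have h0 := sum_inv_pow_six_le xs hδ hxsep (e ⟨x, hxT⟩)
      have hxy : xs (e ⟨x, hxT⟩) = x := by simp [hxs]
      rw [hxy] at h0
      refine le_trans (le_of_eq ?_) h0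
      refine Finset.sum_bij' (fun z hz => e ⟨z, (Finset.mem_erase.1 hz).2⟩)
        (fun k _ => (e.symm k : EuclideanSpace ℝ (Fin 3))) ?_ ?_ ?_ ?_ ?_
      · intro z hz
        refine Finset.mem_erase.2 ⟨fun h' => (Finset.mem_erase.1 hz).1 ?_, Finset.mem_univ _⟩
        have := congrArg (fun i => (e.symm i : EuclideanSpace ℝ (Fin 3))) h'
        simpa using this
      · intro k hk
        refine Finset.mem_erase.2 ⟨fun h' => (Finset.mem_erase.1 hk).1 ?_, (e.symm k).2⟩
        have : e.symm k = ⟨x, hxT⟩ := Subtype.ext h'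
        rw [← this, Equiv.apply_symm_apply]
      · intro z hz
        simp
      · intro k hk
        simp
      · intro z hz
        simp [hxs]
    have hTe : T.erase x = M := by rw [hT, Finset.erase_insert hxM]
    rw [hTe, hM, Finset.sum_map] at h
    exact h
  exact ⟨summable_of_sum_le hnn hbd, Real.tsum_le_of_sum_le hnn hbd⟩

/-- The Lennard-Jones lattice sum seen from a point `x` of a `δ`-separated set `S` is
`≥ -(250/6)·δ⁻⁶` — also when it is not summable (junk value `0`). [folklore] -/
theorem neg_le_tsum_lennardJones (hδ : 0 < δ)
    (hsep : ∀ a ∈ S, ∀ b ∈ S, a ≠ b → δ ≤ dist a b) {x : EuclideanSpace ℝ (Fin 3)} (hx : x ∈ S) :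
    -(250 / 6 * δ⁻¹ ^ 6) ≤ ∑' y : {y : EuclideanSpace ℝ (Fin 3) // y ∈ S ∧ y ≠ x}, lennardJones (dist x y.1) := by
  have hC : (0 : ℝ) ≤ 250 / 6 * δ⁻¹ ^ 6 := by positivity
  by_cases hV : Summable (fun y : {y : EuclideanSpace ℝ (Fin 3) // y ∈ S ∧ y ≠ x} => lennardJones (dist x y.1))
  · obtain ⟨hw, hle⟩ := summable_inv_pow_six hδ hsep hx
    have hw' : Summable (fun y : {y : EuclideanSpace ℝ (Fin 3) // y ∈ S ∧ y ≠ x} => -(1 / 6) * (dist x y.1)⁻¹ ^ 6) :=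
      hw.mul_left _
    have hpt : ∀ y : {y : EuclideanSpace ℝ (Fin 3) // y ∈ S ∧ y ≠ x},
        -(1 / 6) * (dist x y.1)⁻¹ ^ 6 ≤ lennardJones (dist x y.1) := by
      intro y
      have : 0 ≤ (1 / 12) * ((dist x y.1)⁻¹) ^ 12 := by positivity
      unfold lennardJones
      linarith
    have h1 := Summable.tsum_le_tsum hpt hw' hV
    rw [tsum_mul_left] at h1
    linarith
  · rw [tsum_eq_zero_of_not_summable hV]
    linarith

end Separated

/-! ### Periodic configurations -/

/-- Energy per particle of a periodic configuration with `δ`-separated point set is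
`≥ -(250/12)·δ⁻⁶`. [folklore] -/
theorem neg_le_energyPerParticle_of_separated {δ : ℝ} (hδ : 0 < δ) (Q : PeriodicConfiguration 3)
    (hsep : ∀ a ∈ Q.points, ∀ b ∈ Q.points, a ≠ b → δ ≤ dist a b) :
    -(250 / 12 * δ⁻¹ ^ 6) ≤ Q.energyPerParticle lennardJones := by
  unfold PeriodicConfiguration.energyPerParticle
  have hm : 0 < (Q.motif.card : ℝ) := by exact_mod_cast Finset.card_pos.2 Q.motif_nonempty
  have hsum : ∑ x ∈ Q.motif, (-(250 / 6 * δ⁻¹ ^ 6)) ≤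
      ∑ x ∈ Q.motif, ∑' y : {y : EuclideanSpace ℝ (Fin 3) // y ∈ Q.points ∧ y ≠ x}, lennardJones (dist x y.1) :=
    Finset.sum_le_sum fun x hx => neg_le_tsum_lennardJones hδ hsep (Q.mem_points_of_mem_motif hx)
  rw [Finset.sum_const, nsmul_eq_mul] at hsum
  have h2 : (0 : ℝ) < (2 * (Q.motif.card : ℝ))⁻¹ := by positivity
  calc -(250 / 12 * δ⁻¹ ^ 6)
      = (2 * (Q.motif.card : ℝ))⁻¹ * ((Q.motif.card : ℝ) * (-(250 / 6 * δ⁻¹ ^ 6))) := by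
        field_simp
        ring
    _ ≤ (2 * (Q.motif.card : ℝ))⁻¹ *
          ∑ x ∈ Q.motif, ∑' y : {y : EuclideanSpace ℝ (Fin 3) // y ∈ Q.points ∧ y ≠ x}, lennardJones (dist x y.1) :=
        mul_le_mul_of_nonneg_left hsum h2.le

/-- A translate of a point set is `δ`-separated iff the point set is; we need one direction.
[folklore] -/
theorem separated_of_translate {δ : ℝ} {A : Set (EuclideanSpace ℝ (Fin 3))} {t : EuclideanSpace ℝ (Fin 3)}
    (hsep : ∀ p ∈ (fun s => s + t) '' A, ∀ q ∈ (fun s => s + t) '' A, p ≠ q → δ ≤ dist p q) :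
    ∀ a ∈ A, ∀ b ∈ A, a ≠ b → δ ≤ dist a b := by
  intro a ha b hb hab
  have h := hsep (a + t) ⟨a, ha, rfl⟩ (b + t) ⟨b, hb, rfl⟩ (fun h => hab (add_right_cancel h))
  simpa using h

/-- **DILUTE RUNG of D.** For `δ ≥ 3`, every periodic configuration of `ℝ³` some translate of
whose point set is `δ`-separated has energy per particle strictly above the periodic infimum:
`e⋆ < e(Q)` (`e(Q) ≥ -(250/12)·3⁻⁶ > -1/24 ≥ e⋆`). [folklore] -/
theorem eStar_lt_energyPerParticle_of_three_le :
    ∀ δ : ℝ, 3 ≤ δ → ∀ (Q : PeriodicConfiguration 3) (t : EuclideanSpace ℝ (Fin 3)),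
      (∀ p ∈ (fun s => s + t) '' Q.points, ∀ q ∈ (fun s => s + t) '' Q.points, p ≠ q → δ ≤ dist p q) →
      (⨅ Q : PeriodicConfiguration 3, Q.energyPerParticle lennardJones) <
        Q.energyPerParticle lennardJones := by
  intro δ hδ Q t hsep
  have hδ0 : 0 < δ := by linarith
  have h1 := neg_le_energyPerParticle_of_separated hδ0 Q (separated_of_translate hsep)
  -- `e⋆ ≤ -1/24`: periodise the unit dimer (`e⋆ ≤ E(2)/2`, `E(2) ≤ V_LJ(1) = -1/12`;
  -- = `PricedLinkCensusLocalToGlobalPhaseGap.eStar_le_neg`, inlined)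
  have h2 : eStar ≤ -1 / 24 := by
    have h1' : eStar ≤ groundStateEnergy lennardJones 3 2 / 2 := by
      simpa using eStar_le_groundStateEnergy_div (N := 2) two_pos
    have h2' : groundStateEnergy lennardJones 3 2 ≤ -1 / 12 := by
      have := groundStateEnergy_lennardJones_le (d := 3) dimer_injective
      rwa [interactionEnergy_dimer] at this
    linarith
  have h3 : δ⁻¹ ^ 6 ≤ (3 : ℝ)⁻¹ ^ 6 :=
    pow_le_pow_left₀ (inv_nonneg.2 hδ0.le) ((inv_le_inv₀ hδ0 (by norm_num)).2 hδ) 6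
  have h4 : ((3 : ℝ)⁻¹) ^ 6 = 1 / 729 := by norm_num
  show eStar < _
  rw [h4] at h3
  linarith

/-- **DILUTE RUNG in D's exact binder shape**: the crux `NoFrustratedPeriodicMinimiser` of the
child route «PeriodicChargeSplit» with its hard-core parameter restricted to `δ ≥ 3` (its texture
and Nash hypotheses are carried verbatim and not used in this window). [folklore] -/
theorem noFrustratedPeriodicMinimiser_dilute_rung :
    ∀ δ : ℝ, 3 ≤ δ → ∀ (Q : Literature.MathematicalPhysics.StatisticalMechanics.PeriodicConfiguration 3) (t : EuclideanSpace ℝ (Fin 3)), let Gy : ℝ → (N : ℕ) → (Fin N → EuclideanSpace ℝ (Fin 3)) → Fin N → Prop := fun η N y j => let d : ℝ := sInf ((fun z => dist z (y (j : Fin N))) '' (Set.range (y) \ {(y (j : Fin N))})); let T : Set (EuclideanSpace ℝ (Fin 3)) := {z : EuclideanSpace ℝ (Fin 3) | z ∈ Set.range (y) ∧ z ≠ (y (j : Fin N)) ∧ dist z (y (j : Fin N)) < 13 / 10 * d}; ∃ A : EuclideanSpace ℝ (Fin 3) →ₗᵢ[ℝ] EuclideanSpace ℝ (Fin 3), (∃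 e : ↥T ≃ ↥Literature.Geometry.DiscreteGeometry.fccKissingPattern, ∀ t : ↥T, dist (d⁻¹ • ((t : EuclideanSpace ℝ (Fin 3)) - (y (j : Fin N)))) (A ((e t : ↥Literature.Geometry.DiscreteGeometry.fccKissingPattern) : EuclideanSpace ℝ (Fin 3))) ≤ η) ∨ (∃ e : ↥T ≃ ↥Literature.Geometry.DiscreteGeometry.hcpKissingPattern, ∀ t : ↥T, dist (d⁻¹ • ((t : EuclideanSpace ℝ (Fin 3)) - (y (j : Fin N)))) (A ((e t : ↥Literature.Geometry.DiscreteGeometry.hcpKissingPattern) : EuclideanSpace ℝ (Fin 3))) ≤ η); let TexBall : (N : ℕ) → (Fin N → EuclideanSpace ℝ (Fin 3)) → Fin N → ℝ → ℝ → ℝ → ℝ → Prop := fun N y i R R₇ R₈ R₉ => (∀ a b : Fin N, a ≠ b → (7 : ℝ) / 10 ≤ dist (y a) (y b)) ∧ (∀ j : Fin N, dist (y j) (y i) ≤ R → ¬ Gy (1 / 20) N (y) j) ∧ (∀ j : Fin N, dist (y j) (y i) ≤ R → ¬ ((∀ j' : Fin N, dist (y j') (y j) ≤ R₇ → ¬ Gy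 (1 / 20) N (y) j') ∧ (∀ z : EuclideanSpace ℝ (Fin 3), dist z (y j) ≤ R₇ → ∃ k : Fin N, dist z (y k) ≤ 1) ∧ (∀ j' : Fin N, dist (y j') (y j) ≤ R₇ → (let d : ℝ := sInf ((fun z => dist z (y j')) '' (Set.range (y) \ {(y j')})); ∀ k : Fin N, y k ≠ y j' → dist (y k) (y j') < 27 / 20 * d → 5 ≤ Nat.card {m : Fin N // y m ≠ y j' ∧ dist (y m) (y j') < 27 / 20 * d ∧ y m ≠ y k ∧ dist (y m) (y k) < 27 / 20 * d})))) ∧ (∀ j : Fin N, dist (y j) (y i) ≤ R → ∃ k : Fin N, dist (y k) (y j) ≤ R₈ ∧ Gy (1 / 8) N (y) k) ∧ (∀ j : Fin N, dist (y j) (y i) ≤ R → ¬ ((∀ j' : Fin N, dist (y j') (y j) ≤ R₉ → ¬ Gy (1 / 20) N (y) j') ∧ (Nat.card {j' : Fin N // dist (y j') (y j) ≤ R₉ ∧ ¬ Gy (1 / 8) N (y) j'} : ℝ) ≤ 1 / 2 * (Nat.card {j' : Fin N // dist (y j') (y j) ≤ R₉} : ℝ) ∧ (∀ j' : Fin N,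 dist (y j') (y j) ≤ R₉ → ¬ Gy (1 / 8) N (y) j' → ¬ (let d : ℝ := sInf ((fun z => dist z (y j')) '' (Set.range (y) \ {(y j')})); ∀ k : Fin N, y k ≠ y j' → dist (y k) (y j') < 27 / 20 * d → 5 ≤ Nat.card {m : Fin N // y m ≠ y j' ∧ dist (y m) (y j') < 27 / 20 * d ∧ y m ≠ y k ∧ dist (y m) (y k) < 27 / 20 * d})))); let ApprS : Set (EuclideanSpace ℝ (Fin 3)) → ℝ → ℝ → ℝ → Prop := fun S R₇ R₈ R₉ => ∀ q : EuclideanSpace ℝ (Fin 3), q ∈ S → ∀ R ε : ℝ, 0 < ε → ∃ (N : ℕ) (y : Fin N → EuclideanSpace ℝ (Fin 3)) (i : Fin N), TexBall N y i R R₇ R₈ R₉ ∧ (∀ p : EuclideanSpace ℝ (Fin 3), p ∈ S → dist p q ≤ R → ∃ k : Fin N, dist (y k - y i) (p - q) ≤ ε) ∧ (∀ k : Fin N, dist (y k) (y i) ≤ R → ∃ p : EuclideanSpace ℝ (Fin 3), p ∈ S ∧ dist (y k - y i) (p - q) ≤ ε); let NashS : Set (EuclideanSpace ℝ (Fin 3))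 → Prop := fun S => ∀ p : EuclideanSpace ℝ (Fin 3), p ∈ S → ∀ y : EuclideanSpace ℝ (Fin 3), (∀ q : EuclideanSpace ℝ (Fin 3), q ∈ S → q ≠ p → y ≠ q) → ∑' q : {q : EuclideanSpace ℝ (Fin 3) // q ∈ S ∧ q ≠ p}, Literature.MathematicalPhysics.StatisticalMechanics.lennardJones (dist p (q : EuclideanSpace ℝ (Fin 3))) ≤ ∑' q : {q : EuclideanSpace ℝ (Fin 3) // q ∈ S ∧ q ≠ p}, Literature.MathematicalPhysics.StatisticalMechanics.lennardJones (dist y (q : EuclideanSpace ℝ (Fin 3))); (∀ p ∈ ((fun s => s + t) '' Q.points), ∀ q ∈ ((fun s => s + t) '' Q.points), p ≠ q → δ ≤ dist p q) → (∃ R₇ R₈ R₉ : ℝ, ApprS ((fun s => s + t) '' Q.points) R₇ R₈ R₉) → NashS ((fun s => s + t) '' Q.points) → (⨅ Q : Literature.MathematicalPhysics.StatisticalMechanics.PeriodicConfiguration 3, Q.energyPerParticle Literature.MathematicalPhysics.StatisticalMechanics.lennardJones) < Q.energyPerParticle Literature.MathematicalPhysics.StatisticalMechanics.lennardJones := by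
  intro δ hδ Q t
  dsimp only
  intro hsep _happr _hnash
  exact eStar_lt_energyPerParticle_of_three_le δ hδ Q t hsep

end Summit.AtomisticToContinuum.Crystallization.Theorems.FrustratedLawDichotomyPeriodicRungs

end
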